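import Mathlib.MeasureTheory.Measure.Lebesgue.VolumeOfBalls
import Literature.Analysis.FluidPDE.HardSphereTorusMeasure
import Literature.MathematicalPhysics.KineticTheory.HardSphereEuler
import Summits.AtomisticToContinuum.HydrodynamicLimit.Theorems.AntiMazurCoboundariesInfluenceLocalityAnchoredCoveringKinematics
import HarnessLib

/-!
# Packing count of a separated family on `𝕋³` (registered stub `stub_packingOfSeparated`,
# refutation line `ignition-cascade-refutation`, crux `InfluenceLocality`, stmt-AtomisticToContinuum-13916)

If the points `p i ∈ 𝕋³` (`i : Fin n`) are pairwise `s`-separated for the minimal-image distance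
`Torus.euclidDist` (`0 < s ≤ 1/4`), then for every centre `x` and radius `D ≥ 0` at most
`128 (2D/s + 2)³` of them lie within distance `D` of `x`.  This is the generic count that discharges
the `packing` field of `IsIgnitionTemplate` (Negative/IgnitionTemplates.lean) for any separated design.

Proof (Haar volume packing).  The open minimal-image balls of radius `s/2` about the `p i` are
pairwise disjoint (triangle inequality) and each has the Haar volume of the Euclidean ball of radius
`s/2` (`Torus.volume_euclidDist_lt`, one chart since `s/2 < 1/2`), i.e. `(4π/3)(s/2)³`
(`EuclideanSpace.volume_ball_fin_three`).  If `D + s/2 < 1/2` their union over the counted indices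
lies in the minimal-image ball of radius `D + s/2` about `x`, whose volume is `(4π/3)(D + s/2)³`,
whence `k ≤ (2D/s + 1)³`; otherwise the union lies in the whole torus, of Haar volume `1`, whence
`k ≤ 6/(π s³) ≤ 2/s³ ≤ 54/s³ ≤ 128 (2D/s + 2)³` because then `D ≥ 1/2 − s/2 ≥ 3/8`.
-/

namespace Summit.AtomisticToContinuum.HydrodynamicLimit.Theorems.InfluenceLocality.Negative

open MeasureTheory Set Metric
open scoped ENNReal
open Literature.Analysis.FluidPDE Literature.MathematicalPhysics.KineticTheory
open Summit.AtomisticToContinuum.HydrodynamicLimit.Theorems.TrueAnchoredInfection (torusDist_triangle)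

noncomputable section

/-- The minimal-image distance to a fixed point of `𝕋ᵈ` is continuous. -/
theorem continuous_torusDist_left {d : Type*} [Fintype d] (c : UnitAddTorus d) :
    Continuous fun y : UnitAddTorus d => Torus.euclidDist y c := by
  have h1 := (Torus.continuous_norm_reprSym (d := d)).comp (continuous_sub_right c)
  simpa only [Function.comp_def, Torus.euclidDist] using h1

/-- An open minimal-image ball of `𝕋ᵈ` is measurable. -/
theorem measurableSet_torusBall {d : Type*} [Fintype d] (c : UnitAddTorus d) (r : ℝ) :
    MeasurableSet {y : UnitAddTorus d | Torus.euclidDist y c < r} :=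
  measurableSet_lt (continuous_torusDist_left c).measurable measurable_const

/-- The open minimal-image balls of radius `s/2` about the points of an `s`-separated family of `𝕋ᵈ`
are pairwise disjoint. -/
theorem pairwiseDisjoint_torusBall_of_separated {d : Type*} [Fintype d] {ι : Type*}
    (p : ι → UnitAddTorus d) {s : ℝ} (hsep : ∀ i j, i ≠ j → s ≤ Torus.euclidDist (p i) (p j))
    (I : Set ι) :
    I.PairwiseDisjoint fun i => {y : UnitAddTorus d | Torus.euclidDist y (p i) < s / 2} := by
  intro i _ j _ hij
  refine Set.disjoint_left.2 fun y hyi hyj => ?_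
  have h1 := torusDist_triangle (p i) y (p j)
  rw [Torus.euclidDist_comm (p i) y] at h1
  have h2 := hsep i j hij
  simp only [mem_setOf_eq] at hyi hyj
  linarith

/-- The Lebesgue volume of a Euclidean ball of `ℝ³`, as a real number: `(4π/3) r³`. -/
theorem toReal_volume_ball_fin_three {r : ℝ} (hr : 0 ≤ r) :
    (volume (ball (0 : EuclideanSpace ℝ (Fin 3)) r)).toReal = r ^ 3 * (Real.pi * 4 / 3) := by
  rw [EuclideanSpace.volume_ball_fin_three, ENNReal.toReal_mul, ENNReal.toReal_pow,
    ENNReal.toReal_ofReal hr, ENNReal.toReal_ofReal (by positivity)]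

/-- **Volume packing on `𝕋³`.** For an `s`-separated family `p` (`0 ≤ s < 1`) and a finite set `S` of
indices, if the union of the minimal-image balls of radius `s/2` about the `p i`, `i ∈ S`, lies in a set
`U`, then `#S · (4π/3)(s/2)³ ≤ vol U`. -/
theorem card_mul_volume_ball_le_of_separated {n : ℕ} (p : Fin n → T3) {s : ℝ} (hs0 : 0 ≤ s)
    (hs1 : s < 1) (hsep : ∀ i j, i ≠ j → s ≤ Torus.euclidDist (p i) (p j)) (S : Finset (Fin n))
    {U : Set T3} (hU : (⋃ i ∈ S, {y : T3 | Torus.euclidDist y (p i) < s / 2}) ⊆ U) :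
    (S.card : ℝ) * ((s / 2) ^ 3 * (Real.pi * 4 / 3)) ≤ (volume U).toReal := by
  have hUnion : volume (⋃ i ∈ S, {y : T3 | Torus.euclidDist y (p i) < s / 2}) =
      (S.card : ℝ≥0∞) * volume (ball (0 : EuclideanSpace ℝ (Fin 3)) (s / 2)) := by
    rw [measure_biUnion_finset (pairwiseDisjoint_torusBall_of_separated p hsep _)
      fun i _ => measurableSet_torusBall (p i) _, Finset.sum_congr rfl fun i _ =>
      Torus.volume_euclidDist_lt (by linarith) (p i), Finset.sum_const, nsmul_eq_mul]
  have h1 : (S.card : ℝ≥0∞) * volume (ball (0 : EuclideanSpace ℝ (Fin 3)) (s / 2)) ≤ volume U := by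
    rw [← hUnion]; exact measure_mono hU
  have h2 := ENNReal.toReal_mono (measure_ne_top _ _) h1
  rwa [ENNReal.toReal_mul, ENNReal.toReal_natCast,
    toReal_volume_ball_fin_three (by linarith)] at h2

/-- **Registered stub `stub_packingOfSeparated`** (line `ignition-cascade-refutation`, crux
`InfluenceLocality`). If the points `p i` of `𝕋³` are pairwise `s`-separated in minimal-image distance,
`0 < s ≤ 1/4`, then at most `128 (2D/s + 2)³` of them lie within distance `D ≥ 0` of any point `x`. -/
theorem stub_packingOfSeparated {n : ℕ} (p : Fin n → T3) {s : ℝ} (hs : 0 < s) (hs1 : s ≤ 1 / 4)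
    (hsep : ∀ i j, i ≠ j → s ≤ Torus.euclidDist (p i) (p j)) (x : T3) {D : ℝ} (hD : 0 ≤ D) :
    ((Finset.univ.filter fun i => Torus.euclidDist (p i) x ≤ D).card : ℝ) ≤ 128 * (2 * D / s + 2) ^ 3 := by
  set S : Finset (Fin n) := Finset.univ.filter fun i => Torus.euclidDist (p i) x ≤ D with hS
  have hstep : ∀ U : Set T3, (⋃ i ∈ S, {y : T3 | Torus.euclidDist y (p i) < s / 2}) ⊆ U →
      (S.card : ℝ) * ((s / 2) ^ 3 * (Real.pi * 4 / 3)) ≤ (volume U).toReal := fun U hU =>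
    card_mul_volume_ball_le_of_separated p hs.le (by linarith) hsep S hU
  have hs2 : (0 : ℝ) < s / 2 := by linarith
  have hpi := Real.pi_gt_three
  have hsne : s ≠ 0 := hs.ne'
  by_cases hcase : D + s / 2 < 1 / 2
  · -- one chart: the union of the small balls lies in the ball of radius `D + s/2` about `x`
    have hsub : (⋃ i ∈ S, {y : T3 | Torus.euclidDist y (p i) < s / 2}) ⊆
        {y : T3 | Torus.euclidDist y x < D + s / 2} := by
      intro y hy
      simp only [mem_iUnion, exists_prop] at hy
      obtain ⟨i, hi, hyi⟩ := hy
      have hiD : Torus.euclidDist (p i) x ≤ D := (Finset.mem_filter.1 hi).2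
      simp only [mem_setOf_eq] at hyi ⊢
      have := torusDist_triangle y (p i) x
      linarith
    have hA := hstep _ hsub
    rw [Torus.volume_euclidDist_lt hcase x, toReal_volume_ball_fin_three (by linarith)] at hA
    have hk : (S.card : ℝ) * (s / 2) ^ 3 ≤ (D + s / 2) ^ 3 := by
      have hc : (0 : ℝ) < Real.pi * 4 / 3 := by positivity
      have hA' : (S.card : ℝ) * (s / 2) ^ 3 * (Real.pi * 4 / 3) ≤
          (D + s / 2) ^ 3 * (Real.pi * 4 / 3) := by
        rw [mul_assoc]; exact hA
      exact le_of_mul_le_mul_right hA' hc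
    have hid : D + s / 2 = (2 * D / s + 1) * (s / 2) := by
      field_simp
    have hk2 : (S.card : ℝ) ≤ (2 * D / s + 1) ^ 3 := by
      rw [hid, mul_pow] at hk
      exact le_of_mul_le_mul_right hk (pow_pos hs2 3)
    have ht : 0 ≤ 2 * D / s + 1 := by positivity
    have ht3 : 0 ≤ (2 * D / s + 2) ^ 3 := by positivity
    calc (S.card : ℝ) ≤ (2 * D / s + 1) ^ 3 := hk2
      _ ≤ (2 * D / s + 2) ^ 3 := by gcongr; norm_num
      _ ≤ 128 * (2 * D / s + 2) ^ 3 := by linarith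
  · -- the whole torus has Haar volume `1`
    push Not at hcase
    haveI : IsProbabilityMeasure (volume : Measure UnitAddCircle) := ⟨UnitAddCircle.measure_univ⟩
    have hB := hstep univ (subset_univ _)
    rw [measure_univ, ENNReal.toReal_one] at hB
    have hk : (S.card : ℝ) * s ^ 3 ≤ 2 := by
      have h0 : (0 : ℝ) ≤ (S.card : ℝ) * s ^ 3 := by positivity
      nlinarith [mul_nonneg h0 (sub_nonneg.2 hpi.le)]
    have hDl : 3 / 8 ≤ D := by linarith
    have hts : 3 / 4 ≤ (2 * D / s + 2) * s := by
      have : (2 * D / s + 2) * s = 2 * D + 2 * s := by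
        field_simp
      rw [this]; linarith
    have hts3 : (3 / 4 : ℝ) ^ 3 ≤ ((2 * D / s + 2) * s) ^ 3 := pow_le_pow_left₀ (by norm_num) hts 3
    refine le_of_mul_le_mul_right ?_ (pow_pos hs 3)
    calc (S.card : ℝ) * s ^ 3 ≤ 2 := hk
      _ ≤ 128 * ((2 * D / s + 2) * s) ^ 3 := by nlinarith [hts3]
      _ = 128 * (2 * D / s + 2) ^ 3 * s ^ 3 := by ring

end

end Summit.AtomisticToContinuum.HydrodynamicLimit.Theorems.InfluenceLocality.Negative
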